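import Summits.QuantumFields.YangMills.Theorems.LuscherReductionTwistedTraceScalingBOStiffQuasimodeSlice
import Summits.QuantumFields.YangMills.Theorems.LuscherReductionTwistedTraceScalingBOStiffQuasimodeTwins
import Summits.QuantumFields.YangMills.Theorems.LuscherReductionTwistedTraceScalingBOStiffQuasimodeFrame
import Summits.QuantumFields.YangMills.Theorems.LuscherReductionTwistedTraceScalingBOStiffCentralWeight
import Summits.QuantumFields.YangMills.Theorems.LuscherReductionTwistedTraceScalingBOStiffCentralUpper
import Summits.QuantumFields.YangMills.Theorems.LuscherReductionTwistedTraceScalingBOStiffWeightTransport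
import HarnessLib

/-!
# (B-ST) (W1-10 (A4), part 3) `…BOStiffQuasimodeAtom`: the cM-twins WITHOUT tail and the (Q±) MODEL ATOM of ✓`spec_S3_of_model` — hence `spec_S3` unconditionally
# (lane A of S-BASE, crux `TwistedTraceScaling` stmt-QuantumFields-20203, C4-CORE, the (B-ST) pen; (A) split (A4)/(A5); cdisprove R67/R68: exact exponent, absolute o(1))

* §1 ★ `eventually_tail_le_flat`: on `cS × cS` the absolute tail `(e^{2β})^{|E|}e^{−ℓ⁴/(144L²)}` of ✓`cM_upper` is `≤ ε·cA·cK` (the flat kernel is `≥ (e^{2β})^{|E|}·c·e^{−(d+100)ℓ²−2}` there: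
  (A1) + `‖latCurl‖² ≤ 96‖·‖²` + `β r_f² ≤ ℓ²` + the weight floor ★ `fpWeightBar_powScale_half_ge`), so ★ `eventually_cM_flat_twins`: `(1−ε)cA·cK ≤ cM ≤ (1+ε)cA·cK` on `cS²`.
* §2 ★★★ `quasimode_model_full`: ∀ M ≥ M₀ ∀ σ > 0 ∀ᶠ β ∃ λ > 0: (Q+) `∫cM(x,·)cΘdπ ≤ (1+σ)λ·cΘ(x)cW(x)` on `cS`, (Q−) `≥ (1−σ)λ·cΘcW` on `I = cS ∩ {‖x̂‖ ≤ r_f/12}`,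
  the SAME two-sided statement for the model jump `cK` at level `λ/cA` ((A5) for the lead), the ring clause, and `0 < ∫cΘ²cW` — from ✓`quasimode_of_twins` fed with §1,
  ✓`eventually_slice_two_sided`, `cΘ·cW = e^{−q}·N` (✓`cΘ_mul_cW_eq`), `N ∈ N̄(1±κ)` (✓`fpWeight_record_sandwich`), ✓`eventually_ring_mass_le`.
* §3 ★★★ `quasimode_model` = the hypothesis `hmodel` of ✓`spec_S3_of_model` VERBATIM, and ★★★ `spec_S3` = its conclusion (the `hS3` of ✓`hST_record_of_specs` / ✓`recordAnalyticInput_of_specs`),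
  both UNCONDITIONAL for `Nonempty (NzSite L)`, `2 ≤ L`, `1/6 < s < 1/4`.
HONEST FRAMING: this closes analytic atom (A) = spec_S3 of the (B-ST) pen, a stub of a child of the CONDITIONAL route R2b1; spec_gap_inputs (hflat) is the other atom; (B-ST),
C4-CORE remain OPEN; not infinite volume, not a gap, not Clay.  L-price visible: every constant here depends on `L` (through `|E|`, `flatDim`, `gramDet`, `ρ₀`, `κ_β`).
-/

set_option autoImplicit false

noncomputable section

open MeasureTheory Filter Topology Real
open scoped BigOperators RealInnerProductSpace NNReal ENNReal
open Literature.MathematicalPhysics.QuantumFieldTheory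
open Literature.MathematicalPhysics.QuantumLattice

namespace Summit.QuantumFields.YangMills.Theorems.FemtoTransferGap.TwoLattice.ConstTube

open Summit.QuantumFields.YangMills.Theorems.FemtoTransferGap
open Summit.QuantumFields.YangMills.Theorems.FemtoTransferGap.TwoLattice
open Summit.QuantumFields.YangMills.Theorems.FemtoTransferGap.TwoLattice.Stiff
open Summit.QuantumFields.YangMills.Theorems.FemtoTransferGap.TwoLattice.GnChart
open Summit.QuantumFields.YangMills.Theorems.FemtoTransferGap.TwoLattice.Avg

variable {L : ℕ} [NeZero L]

/-! ## §1 The tail of `cM_upper` is negligible against the flat kernel on `cS × cS` -/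

/-- `fpWeightBar(β^{-1/2}) ≥ c·(β^{-1})^{flatDim}` for `β ≥ 4`, with an explicit `c > 0`. [folklore] -/
theorem fpWeightBar_powScale_half_ge :
    ∃ c : ℝ, 0 < c ∧ ∀ β : ℝ, 4 ≤ β → c * powScale 1 β ^ flatDim L ≤ fpWeightBar L (powScale (1 / 2) β) := by
  refine ⟨((2 * π ^ 2)⁻¹) ^ Fintype.card (NzSite L) / Real.sqrt (gramDet L 0), by
    have := gramDet_zero_pos L; positivity, fun β hβ => ?_⟩
  have hβ1 : 1 ≤ β := by linarith
  have hp0 : 0 < powScale 1 β := powScale_pos 1 β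
  have hp : powScale 1 β = β⁻¹ := by rw [← powScale_half_sq' β, powScale_half_sq hβ1]
  have hp4 : powScale 1 β ≤ 1 / 4 := by
    rw [hp]; exact (inv_le_inv₀ (by linarith) (by norm_num)).mpr hβ |>.trans (by norm_num)
  have hbase0 : 0 < π * powScale 1 β := by positivity
  have hbase1 : π * powScale 1 β ≤ 1 := by nlinarith [Real.pi_le_four]
  have hrpow : (π * powScale 1 β) ^ (flatDim L : ℝ) ≤ (π * powScale 1 β) ^ ((flatDim L : ℝ) / 2) :=
    Real.rpow_le_rpow_of_exponent_ge hbase0 hbase1 (by have : (0 : ℝ) ≤ flatDim L := Nat.cast_nonneg _; linarith)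
  rw [Real.rpow_natCast] at hrpow
  have hpow : powScale 1 β ^ flatDim L ≤ (π * powScale 1 β) ^ flatDim L := by
    rw [mul_pow]; exact le_mul_of_one_le_left (pow_nonneg hp0.le _) (one_le_pow₀ (by linarith [Real.pi_gt_three]))
  have hsq : 0 < Real.sqrt (gramDet L 0) := Real.sqrt_pos.mpr (gramDet_zero_pos L)
  unfold fpWeightBar
  rw [powScale_half_sq' β, show ((flatDim L : ℝ) / 2) = (flatDim L / 2 : ℝ) by norm_num] at *
  calc ((2 * π ^ 2)⁻¹) ^ Fintype.card (NzSite L) / Real.sqrt (gramDet L 0) * powScale 1 β ^ flatDim L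
      = ((2 * π ^ 2)⁻¹) ^ Fintype.card (NzSite L) * powScale 1 β ^ flatDim L / Real.sqrt (gramDet L 0) := by ring
    _ ≤ ((2 * π ^ 2)⁻¹) ^ Fintype.card (NzSite L) * (π * powScale 1 β) ^ ((flatDim L : ℝ) / 2) / Real.sqrt (gramDet L 0) :=
        div_le_div_of_nonneg_right (mul_le_mul_of_nonneg_left (hpow.trans hrpow) (by positivity)) hsq.le

/-- `‖v − P_Γ v‖ ≤ ‖v‖`. [folklore] -/
theorem norm_sub_gaugeProj_le (v : LinkSpace L) : ‖v - (gaugeModes L).starProjection v‖ ≤ ‖v‖ := by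
  rw [← Submodule.starProjection_orthogonal_val]; exact Submodule.norm_starProjection_apply_le _ _

set_option maxHeartbeats 800000 in
-- record-size exponent bookkeeping.
/-- ★ **THE TAIL IS NEGLIGIBLE AGAINST THE FLAT KERNEL**: for every `ε > 0`, eventually `(e^{2β})^{|E|}·e^{−ℓ⁴/(144L²)} ≤ ε·cA_β·cK_β(x,x')` for all `x, x' ∈ cS_β`. [folklore] -/
theorem eventually_tail_le_flat {ε : ℝ} (hε : 0 < ε) :
    ∀ᶠ β : ℝ in atTop, ∀ x ∈ cS L β, ∀ x' ∈ cS L β,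
      Real.exp (2 * β) ^ Fintype.card (Edge 3 L) * Real.exp (-(btLog β ^ 4 / (144 * (L : ℝ) ^ 2))) ≤ ε * (cA L β * cK L β x x') := by
  obtain ⟨c, hc, hfp⟩ := fpWeightBar_powScale_half_ge (L := L)
  have hL1 : (1 : ℝ) ≤ L := by exact_mod_cast Nat.one_le_iff_ne_zero.mpr (NeZero.ne L)
  set A : ℝ := 144 * (L : ℝ) ^ 2 * (((flatDim L : ℝ) + 100) + 2 + |Real.log (ε * c)|) with hA
  filter_upwards [eventually_ge_atTop (4 : ℝ), eventually_action_hessian_cS (L := L) one_pos, Real.tendsto_log_atTop.eventually_ge_atTop A]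
    with β hβ4 hA1 hlogA x hx x' hx'
  have hβ1 : 1 ≤ β := by linarith
  have hβ0 : 0 < β := by linarith
  have hℓlog : Real.log β ≤ btLog β := le_max_left _ _
  have hℓ1 : 1 ≤ btLog β := one_le_btLog β
  have hℓA : A ≤ btLog β ^ 2 := hlogA.trans (hℓlog.trans (by nlinarith))
  -- `β‖x̂‖² ≤ ℓ²` on `cS`
  have hr0 : 0 ≤ min (1 / 40) (powScale (1 / 2) β * btLog β) := le_min (by norm_num) (mul_nonneg (powScale_pos _ _).le (by linarith))
  have hrℓ : β * (min (1 / 40) (powScale (1 / 2) β * btLog β)) ^ 2 ≤ btLog β ^ 2 := by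
    have h1 : (min (1 / 40) (powScale (1 / 2) β * btLog β)) ^ 2 ≤ (powScale (1 / 2) β * btLog β) ^ 2 := pow_le_pow_left₀ hr0 (min_le_right _ _) 2
    calc β * (min (1 / 40) (powScale (1 / 2) β * btLog β)) ^ 2 ≤ β * (powScale (1 / 2) β * btLog β) ^ 2 := mul_le_mul_of_nonneg_left h1 hβ0.le
      _ = btLog β ^ 2 := by rw [mul_pow, powScale_half_sq hβ1, ← mul_assoc, mul_inv_cancel₀ hβ0.ne', one_mul]
  have hnorm : ∀ y ∈ cS L β, β * ‖linkEmbed L y‖ ^ 2 ≤ btLog β ^ 2 := fun y hy =>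
    (mul_le_mul_of_nonneg_left (pow_le_pow_left₀ (norm_nonneg _) (mem_cS hy).2 2) hβ0.le).trans hrℓ
  -- (i) magnetic factors
  have hS : ∀ y ∈ cS L β, β / 2 * wilsonAction su2Rep (orthoTube L 1 y) ≤ 48 * btLog β ^ 2 + 1 := by
    intro y hy
    have h := (abs_le.mp (hA1 y hy)).2
    have hin : ⟪linkEmbed L y, ((β / 2) • stiffHessian L) (linkEmbed L y)⟫ ≤ 48 * (β * ‖linkEmbed L y‖ ^ 2) := by
      rw [LinearMap.smul_apply, real_inner_smul_right, inner_stiffHessian]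
      nlinarith [norm_latCurl_sq_le (linkEmbed L y), hβ0.le]
    linarith [hnorm y hy]
  -- (ii) kinetic factor
  have hkin : β * ‖linkEmbed L (x - x') - (gaugeModes L).starProjection (linkEmbed L (x - x'))‖ ^ 2 ≤ 4 * btLog β ^ 2 := by
    have h1 : ‖linkEmbed L (x - x') - (gaugeModes L).starProjection (linkEmbed L (x - x'))‖ ≤ ‖linkEmbed L x‖ + ‖linkEmbed L x'‖ :=
      (norm_sub_gaugeProj_le _).trans (by rw [map_sub]; exact norm_sub_le _ _)
    have h3 := pow_le_pow_left₀ (norm_nonneg _) h1 2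
    nlinarith [hnorm x hx, hnorm x' hx', sq_nonneg (‖linkEmbed L x‖ - ‖linkEmbed L x'‖), hβ0.le]
  -- (iii) weight floor `c·e^{−dℓ²} ≤ fpWeightBar(β^{-1/2})`
  have hW : c * Real.exp (-((flatDim L : ℝ) * btLog β ^ 2)) ≤ fpWeightBar L (powScale (1 / 2) β) := by
    refine le_trans (mul_le_mul_of_nonneg_left ?_ hc.le) (hfp β hβ4)
    have hp : powScale 1 β = Real.exp (-Real.log β) := by rw [← powScale_half_sq' β, powScale_half_sq hβ1, Real.exp_neg, Real.exp_log hβ0]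
    rw [hp, ← Real.exp_nat_mul]
    have hd : (0 : ℝ) ≤ flatDim L := Nat.cast_nonneg _
    have hlog2 : Real.log β ≤ btLog β ^ 2 := hℓlog.trans (by nlinarith)
    exact Real.exp_le_exp.2 (by nlinarith [mul_le_mul_of_nonneg_left hlog2 hd])
  -- (iv) the exponent inequality
  have hexp : Real.exp (-(btLog β ^ 4 / (144 * (L : ℝ) ^ 2))) ≤ ε * c * Real.exp (-(((flatDim L : ℝ) + 100) * btLog β ^ 2 + 2)) := by
    rw [← Real.exp_log (mul_pos hε hc), ← Real.exp_add]
    refine Real.exp_le_exp.2 ?_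
    have hL2 : (0 : ℝ) < 144 * (L : ℝ) ^ 2 := by positivity
    have hkey : (((flatDim L : ℝ) + 100) * btLog β ^ 2 + 2 + |Real.log (ε * c)|) * (144 * (L : ℝ) ^ 2) ≤ btLog β ^ 4 := by
      have h1 : A * btLog β ^ 2 ≤ btLog β ^ 2 * btLog β ^ 2 := mul_le_mul_of_nonneg_right hℓA (sq_nonneg _)
      have h2 : 1 ≤ btLog β ^ 2 := by nlinarith
      rw [hA] at h1
      have hint : 0 ≤ 144 * (L : ℝ) ^ 2 * (2 + |Real.log (ε * c)|) * (btLog β ^ 2 - 1) :=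
        mul_nonneg (mul_nonneg hL2.le (by positivity)) (sub_nonneg.2 h2)
      nlinarith [hint, h1]
    have := (le_div_iff₀ hL2).mpr hkey
    linarith [neg_abs_le (Real.log (ε * c))]
  -- (v) assemble
  have hE : 0 ≤ Real.exp (2 * β) ^ Fintype.card (Edge 3 L) := by positivity
  have hprod : ε * c * Real.exp (-(((flatDim L : ℝ) + 100) * btLog β ^ 2 + 2)) ≤
      ε * (fpWeightBar L (powScale (1 / 2) β) * (Real.exp (-(β / 2 * (wilsonAction su2Rep (orthoTube L 1 x) + wilsonAction su2Rep (orthoTube L 1 x')))) *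
        Real.exp (-(β * ‖linkEmbed L (x - x') - (gaugeModes L).starProjection (linkEmbed L (x - x'))‖ ^ 2)))) := by
    have e : ε * c * Real.exp (-(((flatDim L : ℝ) + 100) * btLog β ^ 2 + 2)) =
        ε * ((c * Real.exp (-((flatDim L : ℝ) * btLog β ^ 2))) * (Real.exp (-(96 * btLog β ^ 2 + 2)) * Real.exp (-(4 * btLog β ^ 2)))) := by
      have h3 : Real.exp (-(((flatDim L : ℝ) + 100) * btLog β ^ 2 + 2)) =
          Real.exp (-((flatDim L : ℝ) * btLog β ^ 2)) * (Real.exp (-(96 * btLog β ^ 2 + 2)) * Real.exp (-(4 * btLog β ^ 2))) := by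
        rw [← Real.exp_add, ← Real.exp_add]; congr 1; ring
      rw [h3]; ring
    rw [e]
    refine mul_le_mul_of_nonneg_left (mul_le_mul hW (mul_le_mul (Real.exp_le_exp.2 ?_) (Real.exp_le_exp.2 (by linarith)) (Real.exp_pos _).le (Real.exp_pos _).le)
      (by positivity) ((fpWeightBar_pos L (powScale_pos _ _)).le)) hε.le
    have := hS x hx; have := hS x' hx'; nlinarith
  unfold cA cK
  calc Real.exp (2 * β) ^ Fintype.card (Edge 3 L) * Real.exp (-(btLog β ^ 4 / (144 * (L : ℝ) ^ 2)))
      ≤ Real.exp (2 * β) ^ Fintype.card (Edge 3 L) * (ε * (fpWeightBar L (powScale (1 / 2) β) * (Real.exp (-(β / 2 * (wilsonAction su2Rep (orthoTube L 1 x) + wilsonAction su2Rep (orthoTube L 1 x')))) *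
        Real.exp (-(β * ‖linkEmbed L (x - x') - (gaugeModes L).starProjection (linkEmbed L (x - x'))‖ ^ 2))))) := mul_le_mul_of_nonneg_left (hexp.trans hprod) hE
    _ = _ := by ring

/-- ★ **THE cM-TWINS WITHOUT TAIL**: for every `ε > 0`, eventually `(1−ε)·cA·cK ≤ cM ≤ (1+ε)·cA·cK` on `cS × cS` (✓`cM_lower`, ✓`cM_upper`, ★`eventually_tail_le_flat`). [cite: Luscher1983, §3] -/
theorem eventually_cM_flat_twins (hL : Nonempty (NzSite L)) {ε : ℝ} (hε : 0 < ε) :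
    ∀ᶠ β : ℝ in atTop, ∀ x ∈ cS L β, ∀ x' ∈ cS L β,
      (1 - ε) * (cA L β * cK L β x x') ≤ cM L β x x' ∧ cM L β x x' ≤ (1 + ε) * (cA L β * cK L β x x') := by
  filter_upwards [cM_lower (L := L) hL hε, cM_upper (L := L) hL (half_pos hε), eventually_tail_le_flat (L := L) (half_pos hε)] with β hlo hup htl x hx x' hx'
  refine ⟨hlo x hx x' hx', (hup x hx x' hx').trans ?_⟩
  have := htl x hx x' hx'
  unfold cA cK at this ⊢
  linarith

/-! ## §2 The (Q±) model atom -/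

set_option maxHeartbeats 1600000 in
-- record-size data bookkeeping for `quasimode_of_twins`.
/-- ★★★ **THE (Q±) MODEL ATOM, full form**: for `1/6 < s < 1/4` there is `M₀ ≥ 2` such that for all `M ≥ M₀`, `σ > 0`, eventually in `β`, with ONE level `λ > 0`:
(Q+) `∫cM(x,·)cΘdπ ≤ (1+σ)λ·cΘ(x)cW(x)` on `cS`; (Q−) `(1−σ)λ·cΘ(x)cW(x) ≤ ∫cM(x,·)cΘdπ` on `I = cS ∩ {‖x̂‖ ≤ r_f/12}`; the same two bounds for the MODEL JUMP
`cK` at level `λ/cA` ((A5)); the ring clause `∫_{cS∖I}cΘ²cW ≤ σ∫cΘ²cW`; and `0 < ∫cΘ²cW`. [cite: Luscher1983, §3] -/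
theorem quasimode_model_full (hLz : Nonempty (NzSite L)) (hL2 : 2 ≤ L) {s : ℝ} (hs6 : 1 / 6 < s) (hs4 : s < 1 / 4) :
    ∃ M₀ : ℝ, 2 ≤ M₀ ∧ ∀ M : ℝ, M₀ ≤ M → ∀ σ : ℝ, 0 < σ → ∀ᶠ β : ℝ in atTop, ∃ lam : ℝ, 0 < lam ∧
      0 < ∫ x, cΘ L β x ^ 2 * cW L s M β x ∂orthoTransverse L ∧
      (∀ x ∈ cS L β, ∫ y, cM L β x y * cΘ L β y ∂orthoTransverse L ≤ (1 + σ) * lam * (cΘ L β x * cW L s M β x)) ∧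
      (∀ x ∈ cS L β, ‖linkEmbed L x‖ ≤ min (1 / 40) (powScale (1 / 2) β * btLog β) / 12 →
        (1 - σ) * lam * (cΘ L β x * cW L s M β x) ≤ ∫ y, cM L β x y * cΘ L β y ∂orthoTransverse L) ∧
      (∀ x ∈ cS L β, ∫ y, cK L β x y * cΘ L β y ∂orthoTransverse L ≤ (1 + σ) * (lam / cA L β) * (cΘ L β x * cW L s M β x)) ∧
      (∀ x ∈ cS L β, ‖linkEmbed L x‖ ≤ min (1 / 40) (powScale (1 / 2) β * btLog β) / 12 →
        (1 - σ) * (lam / cA L β) * (cΘ L β x * cW L s M β x) ≤ ∫ y, cK L β x y * cΘ L β y ∂orthoTransverse L) ∧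
      ∫ x in cS L β \ (cS L β ∩ {x | ‖linkEmbed L x‖ ≤ min (1 / 40) (powScale (1 / 2) β * btLog β) / 12}), cΘ L β x ^ 2 * cW L s M β x ∂orthoTransverse L ≤
        σ * ∫ x, cΘ L β x ^ 2 * cW L s M β x ∂orthoTransverse L := by
  haveI := isFiniteMeasure_orthoTransverse L
  have hs0 : 0 < s := by linarith
  have hs3 : s ≤ 1 / 3 := by linarith
  have hs2 : s < 1 / 2 := by linarith
  obtain ⟨M₁, hM₁, HP⟩ := fpWeight_record_sandwich (L := L) hLz hs0 hs3
  obtain ⟨M₂, hM₂, HR⟩ := eventually_ring_mass_le (L := L) hLz hL2 hs0 hs3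
  refine ⟨max M₁ M₂, hM₁.trans (le_max_left _ _), fun M hM σ hσ => ?_⟩
  obtain ⟨C, β₀, hC, hP⟩ := HP M (le_of_max_le_left hM)
  have hM2 : 2 ≤ M := hM₁.trans (le_of_max_le_left hM)
  -- the small parameter `a = σ'/8`, `σ' = min σ 1`
  set σ' : ℝ := min σ 1 with hσ'
  have hσ'0 : 0 < σ' := lt_min hσ one_pos
  have hσ'1 : σ' ≤ 1 := min_le_right _ _
  have hσ'σ : σ' ≤ σ := min_le_left _ _
  set a : ℝ := σ' / 8 with ha
  have ha0 : 0 < a := by positivity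
  have ha8 : a ≤ 1 / 8 := by rw [ha]; linarith
  have ha1 : a ≤ 1 := by linarith
  have h1a : 0 < 1 - a := by linarith
  have hδ2 : Tendsto (fun β => (43 * powScale s β) ^ 2) atTop (𝓝 0) := by
    have hδ : Tendsto (fun β => 43 * powScale s β) atTop (𝓝 0) := by simpa using (tendsto_powScale hs0).const_mul 43
    simpa using hδ.pow 2
  filter_upwards [eventually_cM_flat_twins (L := L) hLz ha0, eventually_slice_two_sided (L := L) ha0,
    eventually_orthoTube_one_mem_fatTube_of_norm_le (L := L) hs0 hs2 hM2, eventually_ge_atTop β₀, eventually_mul_le_of_tendsto hδ2 C ha0,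
    HR M (le_of_max_le_right hM) σ hσ, eventually_ge_atTop (1 : ℝ)] with β htw hsl hfat hββ₀ hκa hring hβ1
  obtain ⟨Λ, hΛ, hJup, hJlo⟩ := hsl
  have hβ0 : 0 ≤ β := by linarith
  -- data
  obtain ⟨hMm, -, -, -, hΘm, hΘ1, hΘ0, hΘS, hSm⟩ := central_kform_data (L := L) hβ0
  obtain ⟨CM, hCM⟩ := cM_bounds (L := L) β
  obtain ⟨hWm, hWb, hW0⟩ := cW_props (L := L) s M β
  have hcA : 0 < cA L β := by unfold cA; exact mul_pos (by positivity) (fpWeightBar_pos L (powScale_pos _ _))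
  have hcA' : cA L β ≠ 0 := hcA.ne'
  have hN0 : 0 < fpWeightBar L (powScale 1 β) := fpWeightBar_pos L (powScale_pos _ _)
  have hN0' : fpWeightBar L (powScale 1 β) ≠ 0 := hN0.ne'
  set κ : ℝ := C * (43 * powScale s β) ^ 2 with hκdef
  have hκ0 : 0 ≤ κ := by positivity
  have hκ1 : κ < 1 := by linarith
  have h1κ : 0 < 1 - κ := by linarith
  have hr0 : 0 ≤ min (1 / 40) (powScale (1 / 2) β * btLog β) := le_min (by norm_num) (mul_nonneg (powScale_pos _ _).le (zero_le_one.trans (one_le_btLog β)))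
  -- weights on `cS`
  have hfatS : ∀ x ∈ cS L β, orthoTube L 1 x ∈ fatTubeRho L (fun β => 43 * powScale s β) (fun b => M * (43 * powScale s b)) β :=
    fun x hx => hfat x (mem_cS hx).2
  have hΘw : ∀ x ∈ cS L β, cΘ L β x * cW L s M β x = Real.exp (-(stiffGaussExp L (β / 2) β (linkEmbed L x))) * gaugeAvg (recordChi L s 43 M β) (orthoTube L 1 x) :=
    fun x hx => cΘ_mul_cW_eq (L := L) s M β hx (hfatS x hx)
  have hNlo : ∀ x ∈ cS L β, fpWeightBar L (powScale 1 β) * (1 - κ) ≤ gaugeAvg (recordChi L s 43 M β) (orthoTube L 1 x) := fun x hx => (hP β hββ₀ _ (hfatS x hx)).1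
  have hNup : ∀ x ∈ cS L β, gaugeAvg (recordChi L s 43 M β) (orthoTube L 1 x) ≤ fpWeightBar L (powScale 1 β) * (1 + κ) := fun x hx => (hP β hββ₀ _ (hfatS x hx)).2
  -- hypotheses of `quasimode_of_twins`
  have hK : Measurable (Function.uncurry fun x y => cA L β * cK L β x y) := (measurable_cK (L := L) β).const_mul _
  have hKb : ∀ x y, |cA L β * cK L β x y| ≤ cA L β := fun x y => by
    obtain ⟨h0, h1⟩ := cK_pos_le_one (L := L) hβ0 x y
    rw [abs_of_pos (mul_pos hcA h0)]; exact mul_le_of_le_one_right hcA.le h1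
  have hMint : ∀ x ∈ cS L β, Integrable (fun y => cM L β x y * cΘ L β y) (orthoTransverse L) := fun x _ =>
    integrable_of_measurable_abs_le (orthoTransverse L) ((hMm.comp measurable_prodMk_left).mul hΘm) (C := CM * 1) fun y => by
      rw [abs_mul]; exact mul_le_mul (hCM x y).2.2 (hΘ1 y) (abs_nonneg _) ((abs_nonneg _).trans (hCM x y).2.2)
  have hlo : ∀ x ∈ cS L β, ∀ y ∈ cS L β, (1 - a) * (cA L β * cK L β x y) ≤ cM L β x y := fun x hx y hy => (htw x hx y hy).1
  have hup : ∀ x ∈ cS L β, ∀ y ∈ cS L β, cM L β x y ≤ (1 + a) * (cA L β * cK L β x y) + 0 := fun x hx y hy => by rw [add_zero]; exact (htw x hx y hy).2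
  have hintK : ∀ x, ∫ y, cA L β * cK L β x y * cΘ L β y ∂orthoTransverse L = cA L β * ∫ y, cK L β x y * cΘ L β y ∂orthoTransverse L := fun x => by
    rw [← integral_const_mul]; exact integral_congr_ae (ae_of_all _ fun y => mul_assoc _ _ _)
  have hJup' : ∀ x ∈ cS L β, ∫ y, cA L β * cK L β x y * cΘ L β y ∂orthoTransverse L ≤ (1 + a) * (cA L β * Λ) * Real.exp (-(stiffGaussExp L (β / 2) β (linkEmbed L x))) := by
    intro x hx; rw [hintK]
    calc cA L β * ∫ y, cK L β x y * cΘ L β y ∂orthoTransverse L ≤ cA L β * ((1 + a) * Λ * Real.exp (-(stiffGaussExp L (β / 2) β (linkEmbed L x)))) :=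
          mul_le_mul_of_nonneg_left (hJup x hx) hcA.le
      _ = _ := by ring
  have hJlo' : ∀ x ∈ cS L β ∩ {x | ‖linkEmbed L x‖ ≤ min (1 / 40) (powScale (1 / 2) β * btLog β) / 12},
      (1 - a) * (cA L β * Λ) * Real.exp (-(stiffGaussExp L (β / 2) β (linkEmbed L x))) ≤ ∫ y, cA L β * cK L β x y * cΘ L β y ∂orthoTransverse L := by
    rintro x ⟨hx, hxI⟩; rw [hintK]
    calc (1 - a) * (cA L β * Λ) * Real.exp (-(stiffGaussExp L (β / 2) β (linkEmbed L x)))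
        = cA L β * ((1 - a) * Λ * Real.exp (-(stiffGaussExp L (β / 2) β (linkEmbed L x)))) := by ring
      _ ≤ _ := mul_le_mul_of_nonneg_left (hJlo x hx hxI) hcA.le
  have htail : ∀ x ∈ cS L β, (0 : ℝ) * ∫ y, cΘ L β y ∂orthoTransverse L ≤ 0 * (cA L β * Λ) * Real.exp (-(stiffGaussExp L (β / 2) β (linkEmbed L x))) :=
    fun x _ => by simp
  obtain ⟨hQp, hQm⟩ := quasimode_of_twins (μ := orthoTransverse L) (M := cM L β) (K := fun x y => cA L β * cK L β x y) (Θ := cΘ L β) (w := cW L s M β)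
    (g := fun x => Real.exp (-(stiffGaussExp L (β / 2) β (linkEmbed L x)))) (N := fun x => gaugeAvg (recordChi L s 43 M β) (orthoTube L 1 x))
    (S := cS L β) (I := cS L β ∩ {x | ‖linkEmbed L x‖ ≤ min (1 / 40) (powScale (1 / 2) β * btLog β) / 12})
    hK hKb hΘm hΘ1 hΘ0 hΘS Set.inter_subset_left hMint ha0.le ha1 ha0.le ha1 le_rfl hκ0 hκ1 (mul_pos hcA hΛ).le hN0 (fun x => Real.exp_pos _)
    hlo hup hJup' hJlo' hΘw hNlo hNup htail
  -- the level
  have hlam0 : 0 < cA L β * Λ / fpWeightBar L (powScale 1 β) := by positivity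
  have hlamA : cA L β * Λ / fpWeightBar L (powScale 1 β) / cA L β = Λ / fpWeightBar L (powScale 1 β) := by
    rw [mul_div_assoc, mul_div_cancel_left₀ _ hcA']
  -- constants
  have hP1 : ((1 + a) * (1 + a) + 0) / (1 - κ) ≤ 1 + σ := by
    have h1 : ((1 + a) * (1 + a) + 0) / (1 - κ) ≤ ((1 + a) * (1 + a)) / (1 - a) := by
      rw [add_zero]; exact div_le_div_of_nonneg_left (by positivity) h1a (by linarith)
    have h2 : (1 + a) * (1 + a) / (1 - a) ≤ 1 + σ' := by
      rw [div_le_iff₀ h1a, ha]; nlinarith [mul_nonneg hσ'0.le (sub_nonneg.2 hσ'1)]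
    linarith
  have hP2 : 1 - σ ≤ (1 - a) * (1 - a) / (1 + κ) := by
    have h1 : (1 - a) * (1 - a) / (1 + a) ≤ (1 - a) * (1 - a) / (1 + κ) :=
      div_le_div_of_nonneg_left (by positivity) (by linarith) (by linarith)
    have h2 : 1 - σ' ≤ (1 - a) * (1 - a) / (1 + a) := by rw [le_div_iff₀ (by linarith), ha]; nlinarith
    linarith
  have hΘW0 : ∀ x, 0 ≤ cΘ L β x * cW L s M β x := fun x => mul_nonneg (hΘ0 x) (hW0 x)
  -- (Q±) for `cM`
  have hQp' : ∀ x ∈ cS L β, ∫ y, cM L β x y * cΘ L β y ∂orthoTransverse L ≤ (1 + σ) * (cA L β * Λ / fpWeightBar L (powScale 1 β)) * (cΘ L β x * cW L s M β x) :=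
    fun x hx => (hQp x hx).trans (mul_le_mul_of_nonneg_right (mul_le_mul_of_nonneg_right hP1 hlam0.le) (hΘW0 x))
  have hQm' : ∀ x ∈ cS L β, ‖linkEmbed L x‖ ≤ min (1 / 40) (powScale (1 / 2) β * btLog β) / 12 →
      (1 - σ) * (cA L β * Λ / fpWeightBar L (powScale 1 β)) * (cΘ L β x * cW L s M β x) ≤ ∫ y, cM L β x y * cΘ L β y ∂orthoTransverse L :=
    fun x hx hxI => le_trans (mul_le_mul_of_nonneg_right (mul_le_mul_of_nonneg_right hP2 hlam0.le) (hΘW0 x)) (hQm x ⟨hx, hxI⟩)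
  -- (Q±) for `cK` at level `λ/cA = Λ/N̄`
  have hg : ∀ x ∈ cS L β, Real.exp (-(stiffGaussExp L (β / 2) β (linkEmbed L x))) * (fpWeightBar L (powScale 1 β) * (1 - κ)) ≤ cΘ L β x * cW L s M β x ∧
      cΘ L β x * cW L s M β x ≤ Real.exp (-(stiffGaussExp L (β / 2) β (linkEmbed L x))) * (fpWeightBar L (powScale 1 β) * (1 + κ)) := fun x hx => by
    rw [hΘw x hx]
    exact ⟨mul_le_mul_of_nonneg_left (hNlo x hx) (Real.exp_pos _).le, mul_le_mul_of_nonneg_left (hNup x hx) (Real.exp_pos _).le⟩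
  have hKp : ∀ x ∈ cS L β, ∫ y, cK L β x y * cΘ L β y ∂orthoTransverse L ≤
      (1 + σ) * (cA L β * Λ / fpWeightBar L (powScale 1 β) / cA L β) * (cΘ L β x * cW L s M β x) := by
    intro x hx
    have hc : 1 + a ≤ (1 + σ) * (1 - κ) := by
      have h1 : (1 + σ') * (1 - a) ≤ (1 + σ) * (1 - κ) := mul_le_mul (by linarith) (by linarith) h1a.le (by linarith)
      rw [ha] at h1 ⊢; nlinarith [mul_nonneg hσ'0.le (sub_nonneg.2 hσ'1)]
    rw [hlamA]
    calc ∫ y, cK L β x y * cΘ L β y ∂orthoTransverse L ≤ (1 + a) * Λ * Real.exp (-(stiffGaussExp L (β / 2) β (linkEmbed L x))) := hJup x hx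
      _ ≤ (1 + σ) * (1 - κ) * Λ * Real.exp (-(stiffGaussExp L (β / 2) β (linkEmbed L x))) := by gcongr
      _ = (1 + σ) * (Λ / fpWeightBar L (powScale 1 β)) * (Real.exp (-(stiffGaussExp L (β / 2) β (linkEmbed L x))) * (fpWeightBar L (powScale 1 β) * (1 - κ))) := by
          field_simp
      _ ≤ (1 + σ) * (Λ / fpWeightBar L (powScale 1 β)) * (cΘ L β x * cW L s M β x) := mul_le_mul_of_nonneg_left (hg x hx).1 (by positivity)
  have hKm : ∀ x ∈ cS L β, ‖linkEmbed L x‖ ≤ min (1 / 40) (powScale (1 / 2) β * btLog β) / 12 →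
      (1 - σ) * (cA L β * Λ / fpWeightBar L (powScale 1 β) / cA L β) * (cΘ L β x * cW L s M β x) ≤ ∫ y, cK L β x y * cΘ L β y ∂orthoTransverse L := by
    intro x hx hxI
    have hc : (1 - σ') * (1 + κ) ≤ 1 - a := by
      have h1 : (1 - σ') * (1 + κ) ≤ (1 - σ') * (1 + a) := mul_le_mul_of_nonneg_left (by linarith) (by linarith)
      rw [ha] at h1 ⊢; nlinarith
    rw [hlamA]
    have h1σ : 1 - σ ≤ 1 - σ' := by linarith
    have hpos : 0 ≤ Λ / fpWeightBar L (powScale 1 β) * (cΘ L β x * cW L s M β x) := mul_nonneg (by positivity) (hΘW0 x)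
    calc (1 - σ) * (Λ / fpWeightBar L (powScale 1 β)) * (cΘ L β x * cW L s M β x)
        = (1 - σ) * (Λ / fpWeightBar L (powScale 1 β) * (cΘ L β x * cW L s M β x)) := by ring
      _ ≤ (1 - σ') * (Λ / fpWeightBar L (powScale 1 β) * (cΘ L β x * cW L s M β x)) := mul_le_mul_of_nonneg_right h1σ hpos
      _ ≤ (1 - σ') * (Λ / fpWeightBar L (powScale 1 β) * (Real.exp (-(stiffGaussExp L (β / 2) β (linkEmbed L x))) * (fpWeightBar L (powScale 1 β) * (1 + κ)))) :=
          mul_le_mul_of_nonneg_left (mul_le_mul_of_nonneg_left (hg x hx).2 (by positivity)) (by linarith)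
      _ = (1 - σ') * (1 + κ) * Λ * Real.exp (-(stiffGaussExp L (β / 2) β (linkEmbed L x))) := by field_simp
      _ ≤ (1 - a) * Λ * Real.exp (-(stiffGaussExp L (β / 2) β (linkEmbed L x))) :=
          mul_le_mul_of_nonneg_right (mul_le_mul_of_nonneg_right hc hΛ.le) (Real.exp_pos _).le
      _ ≤ _ := hJlo x hx hxI
  -- positivity of the profile mass: `0 ∈ I`, `∫cK(0,·)cΘ > 0`, `cΘ²cW ≥ c_β·cΘ`
  have hZ : 0 < ∫ x, cΘ L β x ^ 2 * cW L s M β x ∂orthoTransverse L := by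
    have h0bal : (0 : Edge 3 L → Fin 3 → ℝ) ∈ balancedSet L := by simpa using flatMap_mem_balancedSet (L := L) β 0
    have h0S : (0 : Edge 3 L → Fin 3 → ℝ) ∈ cS L β := by
      rw [mem_cS_iff]
      exact ⟨mem_capBalancedSet_of_norm_le h0bal (by rw [map_zero, norm_zero]; norm_num), by rw [map_zero, norm_zero]; exact hr0⟩
    have h0I : ‖linkEmbed L (0 : Edge 3 L → Fin 3 → ℝ)‖ ≤ min (1 / 40) (powScale (1 / 2) β * btLog β) / 12 := by
      rw [map_zero, norm_zero]; positivity
    have hJ0 : 0 < ∫ y, cK L β 0 y * cΘ L β y ∂orthoTransverse L :=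
      lt_of_lt_of_le (mul_pos (mul_pos h1a hΛ) (Real.exp_pos _)) (hJlo 0 h0S h0I)
    have hΘi : Integrable (cΘ L β) (orthoTransverse L) := integrable_of_measurable_abs_le (orthoTransverse L) hΘm hΘ1
    have hKΘi : Integrable (fun y => cK L β 0 y * cΘ L β y) (orthoTransverse L) :=
      integrable_of_measurable_abs_le (orthoTransverse L) (((measurable_cK (L := L) β).comp measurable_prodMk_left).mul hΘm) (C := 1 * 1) fun y => by
        rw [abs_mul, abs_of_pos (cK_pos_le_one (L := L) hβ0 0 y).1]
        exact mul_le_mul (cK_pos_le_one (L := L) hβ0 0 y).2 (hΘ1 y) (abs_nonneg _) zero_le_one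
    have hJΘ : ∫ y, cK L β 0 y * cΘ L β y ∂orthoTransverse L ≤ ∫ y, cΘ L β y ∂orthoTransverse L :=
      integral_mono hKΘi hΘi fun y => mul_le_of_le_one_left (hΘ0 y) (cK_pos_le_one (L := L) hβ0 0 y).2
    set cβ : ℝ := Real.exp (-(49 * β * (min (1 / 40) (powScale (1 / 2) β * btLog β)) ^ 2)) * (fpWeightBar L (powScale 1 β) * (1 - κ)) with hcβ
    have hcβ0 : 0 < cβ := mul_pos (Real.exp_pos _) (mul_pos hN0 h1κ)
    have hpt : ∀ x, cβ * cΘ L β x ≤ cΘ L β x ^ 2 * cW L s M β x := by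
      intro x
      by_cases hx : x ∈ cS L β
      · have hq : stiffGaussExp L (β / 2) β (linkEmbed L x) ≤ 49 * β * (min (1 / 40) (powScale (1 / 2) β * btLog β)) ^ 2 := by
          have h1 := stiffGaussExp_le_mul_norm_sq (L := L) (t := β / 2) (by positivity) (b := β) hβ0 (linkEmbed L x)
          have h2 : ‖linkEmbed L x‖ ^ 2 ≤ (min (1 / 40) (powScale (1 / 2) β * btLog β)) ^ 2 := pow_le_pow_left₀ (norm_nonneg _) (mem_cS hx).2 2
          nlinarith
        have hg1 : Real.exp (-(49 * β * (min (1 / 40) (powScale (1 / 2) β * btLog β)) ^ 2)) ≤ Real.exp (-(stiffGaussExp L (β / 2) β (linkEmbed L x))) :=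
          Real.exp_le_exp.2 (by linarith)
        calc cβ * cΘ L β x ≤ (Real.exp (-(stiffGaussExp L (β / 2) β (linkEmbed L x))) * (fpWeightBar L (powScale 1 β) * (1 - κ))) * cΘ L β x :=
              mul_le_mul_of_nonneg_right (mul_le_mul_of_nonneg_right hg1 (mul_pos hN0 h1κ).le) (hΘ0 x)
          _ ≤ (cΘ L β x * cW L s M β x) * cΘ L β x := mul_le_mul_of_nonneg_right (hg x hx).1 (hΘ0 x)
          _ = cΘ L β x ^ 2 * cW L s M β x := by ring
      · rw [hΘS x hx]; simp
    have hZi : Integrable (fun x => cΘ L β x ^ 2 * cW L s M β x) (orthoTransverse L) :=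
      integrable_of_measurable_abs_le (orthoTransverse L) ((hΘm.pow_const 2).mul hWm) (C := 1 * Real.exp ((Fintype.card (Edge 3 L) : ℝ) / powScale 1 β ^ 2)) fun x => by
        rw [abs_mul, abs_pow]; exact mul_le_mul (by nlinarith [hΘ1 x, abs_nonneg (cΘ L β x)]) (hWb x) (abs_nonneg _) zero_le_one
    calc (0 : ℝ) < cβ * ∫ y, cK L β 0 y * cΘ L β y ∂orthoTransverse L := mul_pos hcβ0 hJ0
      _ ≤ cβ * ∫ y, cΘ L β y ∂orthoTransverse L := mul_le_mul_of_nonneg_left hJΘ hcβ0.le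
      _ = ∫ y, cβ * cΘ L β y ∂orthoTransverse L := (integral_const_mul _ _).symm
      _ ≤ ∫ x, cΘ L β x ^ 2 * cW L s M β x ∂orthoTransverse L := integral_mono (hΘi.const_mul _) hZi hpt
  exact ⟨cA L β * Λ / fpWeightBar L (powScale 1 β), hlam0, hZ, hQp', hQm', hKp, hKm, hring⟩

/-! ## §3 `hmodel` and `spec_S3`, unconditionally -/

/-- ★★★ **THE MODEL ATOM `hmodel` OF ✓`spec_S3_of_model`, VERBATIM and UNCONDITIONAL** (`I := cS ∩ {‖x̂‖ ≤ r_f/12}`). [cite: Luscher1983, §3] -/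
theorem quasimode_model (hLz : Nonempty (NzSite L)) (hL2 : 2 ≤ L) {s : ℝ} (hs6 : 1 / 6 < s) (hs4 : s < 1 / 4) :
    ∃ M₀ : ℝ, 2 ≤ M₀ ∧ ∀ M : ℝ, M₀ ≤ M → ∀ σ : ℝ, 0 < σ → ∀ᶠ β : ℝ in atTop, ∃ (lam : ℝ) (I : Set (Edge 3 L → Fin 3 → ℝ)),
      0 < lam ∧ MeasurableSet I ∧ I ⊆ cS L β ∧ 0 < ∫ x, cΘ L β x ^ 2 * cW L s M β x ∂orthoTransverse L ∧
      (∀ x ∈ cS L β, ∫ y, cM L β x y * cΘ L β y ∂orthoTransverse L ≤ (1 + σ) * lam * (cΘ L β x * cW L s M β x)) ∧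
      (∀ x ∈ I, (1 - σ) * lam * (cΘ L β x * cW L s M β x) ≤ ∫ y, cM L β x y * cΘ L β y ∂orthoTransverse L) ∧
      ∫ x in cS L β \ I, cΘ L β x ^ 2 * cW L s M β x ∂orthoTransverse L ≤ σ * ∫ x, cΘ L β x ^ 2 * cW L s M β x ∂orthoTransverse L := by
  obtain ⟨M₀, hM₀, H⟩ := quasimode_model_full (L := L) hLz hL2 hs6 hs4
  refine ⟨M₀, hM₀, fun M hM σ hσ => ?_⟩
  filter_upwards [H M hM σ hσ] with β hβ
  obtain ⟨lam, hlam, hZ, hQp, hQm, -, -, hring⟩ := hβ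
  exact ⟨lam, cS L β ∩ {x | ‖linkEmbed L x‖ ≤ min (1 / 40) (powScale (1 / 2) β * btLog β) / 12}, hlam,
    (measurableSet_cS β).inter (measurableSet_le (measurable_linkEmbed L).norm measurable_const), Set.inter_subset_left, hZ, hQp,
    fun x hx => hQm x hx.1 hx.2, hring⟩

/-- ★★★ **spec_S3, UNCONDITIONAL** (the `hS3` hypothesis of ✓`hcore_record_of_specs` / ✓`hST_record_of_specs` / ✓`recordAnalyticInput_of_specs`): for `1/6 < s < 1/4` there is
`M₀ ≥ 2` such that for all `M ≥ M₀`, `η, η₂ > 0`, eventually in `β`: (hup) `∫cM(x,·)cΘdπ ≤ (1+η)cΛ·cΘ(x)cW(x)` on `cS`, and (hdef) the quasimode defect is `≤ (η₂cΛ)²∫cΘ²cW`. [cite: Luscher1983, §3] -/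
theorem spec_S3 (hLz : Nonempty (NzSite L)) (hL2 : 2 ≤ L) {s : ℝ} (hs6 : 1 / 6 < s) (hs4 : s < 1 / 4) :
    ∃ M₀ : ℝ, 2 ≤ M₀ ∧ ∀ M : ℝ, M₀ ≤ M → ∀ η : ℝ, 0 < η → ∀ η₂ : ℝ, 0 < η₂ → ∀ᶠ β : ℝ in atTop,
      (∀ x ∈ cS L β, ∫ y, cM L β x y * cΘ L β y ∂orthoTransverse L ≤ (1 + η) * cΛ L s M β * (cΘ L β x * cW L s M β x)) ∧
      (∫ x in cS L β, ((∫ y, cM L β x y * cΘ L β y ∂orthoTransverse L) - cΛ L s M β * (cΘ L β x * cW L s M β x)) ^ 2 / cW L s M β x ∂orthoTransverse L ≤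
        (η₂ * cΛ L s M β) ^ 2 * ∫ x, cΘ L β x ^ 2 * cW L s M β x ∂orthoTransverse L) :=
  spec_S3_of_model (quasimode_model (L := L) hLz hL2 hs6 hs4)

end Summit.QuantumFields.YangMills.Theorems.FemtoTransferGap.TwoLattice.ConstTube

end
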